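import Summits.CriticalPhenomena.PercolationContinuityZ3.Theorems.PercNearOneGluingNoHeavyLowerTailOneCutThreeBlobs
import Summits.CriticalPhenomena.PercolationContinuityZ3.Theorems.PercNearOneGluingNoHeavyLowerTailOneCutThree
import Summits.CriticalPhenomena.PercolationContinuityZ3.Theorems.PercNearOneGluingNoHeavyLowerTailTwoCutMaster
import HarnessLib

/-!
# The one-cut bound for four blobs: the observer-free case and the heavy-blob case

Support file for the crux `NoHeavyLowerTail` (stmt-CriticalPhenomena-4575; routes `PercNearOneGluing`,
`PercNearOneGluingNoHeavy`), BLOB-QUOTIENT analysis of the one-cut engine (depth prover nh-dp-blobmono),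
continuing `…OneCutThreeBlobs.lean` (≤ 3 blobs: the minority event is one pair cut, pure logic).

Setting: `μ = prodBernoulli w` on `Fin n`, relays `A`, observer `o`, `N = |{a ∈ A : o ↔ a}|`,
`E N = Σ_{a∈A} μ(o ↔ a)`, threshold `T = E N/2 ≤ |A|/2`, minority event `B = {1 ≤ N < T}`; a blob
structure `cls : Fin n → Fin b` on `insert o A` (same label ⇒ joined almost surely), masses
`m_i = |A ∩ cls⁻¹ i|`, observer blob `i₀ = cls o`.  This file PROVES:

* `oneCut_of_blobs_heavy` (any number of blobs `b`): if the observer's blob carries a relay `x` and some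
  other blob `k` carrying a relay `y` is HEAVY, `m_{i₀} + m_k ≥ T`, then `B ⊆ {x ↮ y}` up to a null set,
  so the one-cut bound holds.  (On the good set `o ↔ y` forces `N ≥ m_{i₀} + m_k`.)
* `oneCut_of_fourBlobs_of_emptyLabel`: a four-label structure with an unused non-observer label is a
  three-blob structure (relabel), so `oneCut_of_threeBlobs` applies.
* `oneCut_of_fourBlobs_observerFree`: FOUR blobs, the observer's blob carrying NO relay — the one-cut
  bound holds for every `|A|` and every weight, UNCONDITIONALLY.  Two regimes: if some pair of relay blobs
  `{j, k}` is light (`m_j + m_k < T`) the third blob `l` alone is heavy and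
  `B ⊆ {o ↮ y_l} ∩ ({o ↔ x_j} ∪ {o ↔ x_k})`, bounded by the heavy-class exit inequality
  `Theorems.lonelyOrPair_le` (a corollary of the tripod exchange inequality C⁺); otherwise every pair is
  heavy, `B ⊆ {o is joined to exactly one of x_a, x_b, x_c}`, bounded by the lonely-relay lemma
  `Theorems.lonelyRelay_three` (again C⁺).  This generalises `Theorems.oneCut_card_le_three` (the case
  `m = (0;1,1,1)`) to arbitrary masses.

WHAT REMAINS FOR FOUR BLOBS (not proved here; recorded for the planners): the observer's blob carries a
relay and all three other blobs are LIGHT (`m_{i₀} + m_j < T`, `j = a, b, c`).  Then all pairs are heavy,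
`B = {o reaches at most one of the three other blobs}` exactly, the regime forces
`μ(o↮a) + μ(o↮b) + μ(o↮c) < 1`, and the bound needed is the four-terminal inequality
(R4a*) `μ(o↮a)+μ(o↮b)+μ(o↮c) < 1 ⇒ μ{o ↔ at most one of a,b,c} ≤ max_{x≠y∈{o,a,b,c}} μ{x ↮ y}`,
which is FALSE without the premise (weak regime) and holds with constant `3/2` by Markov; R4a* ⇔ the
one-cut bound for all four-blob structures.  Five or more blobs is the general one-cut bound.
-/

noncomputable section

namespace Summit.CriticalPhenomena.PercolationContinuityZ3.Theorems

open MeasureTheory Set Literature.Probability.LatticeModels Literature.Probability.Percolation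
open scoped Classical BigOperators

variable {n : ℕ}

/-! ## Generic tools for blob structures (any number of blobs) -/

/-- The good set of a blob structure has full measure: `μ{∃ u v ∈ insert o A, cls u = cls v, u ↮ v} = 0`.
[folklore] -/
theorem blobs_goodSet_compl_null {b : ℕ} (w : Sym2 (Fin n) → unitInterval) (A : Finset (Fin n))
    (o : Fin n) (cls : Fin n → Fin b)
    (hcls : ∀ u ∈ insert o A, ∀ v ∈ insert o A, cls u = cls v →
      (prodBernoulli w).real (openConn u v)ᶜ = 0) :
    (prodBernoulli w).real {ω : BondConfig (Fin n) | ∀ u ∈ insert o A, ∀ v ∈ insert o A,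
      cls u = cls v → (openGraph ω).Reachable u v}ᶜ = 0 := by
  set μ := prodBernoulli w with hμ
  apply le_antisymm _ measureReal_nonneg
  have hsub : {ω : BondConfig (Fin n) | ∀ u ∈ insert o A, ∀ v ∈ insert o A,
      cls u = cls v → (openGraph ω).Reachable u v}ᶜ ⊆ ⋃ u ∈ insert o A, ⋃ v ∈ insert o A,
      {ω : BondConfig (Fin n) | cls u = cls v ∧ ω ∉ openConn u v} := by
    intro ω hω
    simp only [Set.mem_compl_iff, Set.mem_setOf_eq, not_forall] at hω
    obtain ⟨u, hu, v, hv, huv, hnot⟩ := hω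
    simp only [Set.mem_iUnion, Set.mem_setOf_eq]
    exact ⟨u, hu, v, hv, huv, hnot⟩
  calc μ.real _
      ≤ μ.real (⋃ u ∈ insert o A, ⋃ v ∈ insert o A,
          {ω : BondConfig (Fin n) | cls u = cls v ∧ ω ∉ openConn u v}) :=
        measureReal_mono hsub (measure_ne_top _ _)
    _ ≤ ∑ u ∈ insert o A, μ.real (⋃ v ∈ insert o A,
          {ω : BondConfig (Fin n) | cls u = cls v ∧ ω ∉ openConn u v}) :=
        measureReal_biUnion_finset_le _ _
    _ ≤ ∑ u ∈ insert o A, ∑ v ∈ insert o A,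
          μ.real {ω : BondConfig (Fin n) | cls u = cls v ∧ ω ∉ openConn u v} :=
        Finset.sum_le_sum fun u _ => measureReal_biUnion_finset_le _ _
    _ = 0 := Finset.sum_eq_zero fun u hu => Finset.sum_eq_zero fun v hv => by
        by_cases huv : cls u = cls v
        · have e : {ω : BondConfig (Fin n) | cls u = cls v ∧ ω ∉ openConn u v} = (openConn u v)ᶜ := by
            ext ω; simp [huv]
          rw [e]
          exact hcls u hu v hv huv
        · have e : {ω : BondConfig (Fin n) | cls u = cls v ∧ ω ∉ openConn u v} = ∅ := by
            ext ω; simp [huv]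
          rw [e, measureReal_empty]

/-- Null-set reduction: if the minority event meets the good set inside an event of mass `≤ t`, the
one-cut bound holds. [folklore] -/
theorem oneCut_of_blobs_trap {b : ℕ} (w : Sym2 (Fin n) → unitInterval) (A : Finset (Fin n))
    (o : Fin n) (t : ℝ) (cls : Fin n → Fin b)
    (hcls : ∀ u ∈ insert o A, ∀ v ∈ insert o A, cls u = cls v →
      (prodBernoulli w).real (openConn u v)ᶜ = 0)
    (B E : Set (BondConfig (Fin n)))
    (hBE : B ∩ {ω : BondConfig (Fin n) | ∀ u ∈ insert o A, ∀ v ∈ insert o A,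
      cls u = cls v → (openGraph ω).Reachable u v} ⊆ E)
    (hE : (prodBernoulli w).real E ≤ t) :
    (prodBernoulli w).real B ≤ t := by
  set μ := prodBernoulli w with hμ
  set G := {ω : BondConfig (Fin n) | ∀ u ∈ insert o A, ∀ v ∈ insert o A,
      cls u = cls v → (openGraph ω).Reachable u v} with hG
  have hGc : μ.real Gᶜ = 0 := blobs_goodSet_compl_null w A o cls hcls
  calc μ.real B ≤ μ.real (B ∩ G ∪ Gᶜ) := measureReal_mono fun ω hω => by
          by_cases hωG : ω ∈ G
          · exact Or.inl ⟨hω, hωG⟩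
          · exact Or.inr hωG
    _ ≤ μ.real (B ∩ G) + μ.real Gᶜ := measureReal_union_le _ _
    _ ≤ μ.real E + 0 := by rw [hGc]; exact add_le_add_left (measureReal_mono hBE) _
    _ ≤ t := by linarith

/-- Two-blob count: on the good set, if `o` reaches relays `x` and `y` of two different blobs then every
relay of both blobs is counted: `m_{cls x} + m_{cls y} ≤ N`. [folklore] -/
theorem blobs_count_ge_two {b : ℕ} (A : Finset (Fin n)) (o : Fin n) (cls : Fin n → Fin b)
    (ω : BondConfig (Fin n))
    (hω : ∀ u ∈ insert o A, ∀ v ∈ insert o A, cls u = cls v → (openGraph ω).Reachable u v)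
    {x y : Fin n} (hx : x ∈ A) (hy : y ∈ A) (hox : (openGraph ω).Reachable o x)
    (hoy : (openGraph ω).Reachable o y) (hxy : cls x ≠ cls y) :
    (A.filter fun a => cls a = cls x).card + (A.filter fun a => cls a = cls y).card ≤
      (A.filter fun a => ω ∈ openConn o a).card := by
  rw [← Finset.card_union_of_disjoint
    (Finset.disjoint_filter.2 fun a _ h1 h2 => hxy (h1.symm.trans h2))]
  apply Finset.card_le_card
  intro a ha
  simp only [Finset.mem_union, Finset.mem_filter] at ha ⊢
  rcases ha with ⟨haA, hca⟩ | ⟨haA, hca⟩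
  · exact ⟨haA, hox.trans
      (hω x (Finset.mem_insert_of_mem hx) a (Finset.mem_insert_of_mem haA) hca.symm)⟩
  · exact ⟨haA, hoy.trans
      (hω y (Finset.mem_insert_of_mem hy) a (Finset.mem_insert_of_mem haA) hca.symm)⟩

/-- One-blob count (relay form): on the good set, if `o` reaches a relay `y` then every relay of `y`'s
blob is counted: `m_{cls y} ≤ N`. [folklore] -/
theorem blobs_count_ge_one {b : ℕ} (A : Finset (Fin n)) (o : Fin n) (cls : Fin n → Fin b)
    (ω : BondConfig (Fin n))
    (hω : ∀ u ∈ insert o A, ∀ v ∈ insert o A, cls u = cls v → (openGraph ω).Reachable u v)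
    {y : Fin n} (hy : y ∈ A) (hoy : (openGraph ω).Reachable o y) :
    (A.filter fun a => cls a = cls y).card ≤ (A.filter fun a => ω ∈ openConn o a).card := by
  apply Finset.card_le_card
  intro a ha
  simp only [Finset.mem_filter] at ha ⊢
  exact ⟨ha.1, hoy.trans
    (hω y (Finset.mem_insert_of_mem hy) a (Finset.mem_insert_of_mem ha.1) ha.2.symm)⟩

/-- **Heavy blob ⇒ single cut (any number of blobs).**  If the observer's blob carries a relay `x` and a
relay `y` of another blob has `m_{cls o} + m_{cls y} ≥ E N/2`, then the minority event lies in
`{x ↮ y}` up to a null set, and the one-cut bound holds. [folklore] -/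
theorem oneCut_of_blobs_heavy {b : ℕ} (w : Sym2 (Fin n) → unitInterval) (A : Finset (Fin n))
    (o : Fin n) (t : ℝ) (cls : Fin n → Fin b)
    (hcls : ∀ u ∈ insert o A, ∀ v ∈ insert o A, cls u = cls v →
      (prodBernoulli w).real (openConn u v)ᶜ = 0)
    {x y : Fin n} (hx : x ∈ A) (hcx : cls x = cls o) (hy : y ∈ A) (hcy : cls y ≠ cls o)
    (hheavy : (∑ a ∈ A, (prodBernoulli w).real (openConn o a)) / 2 ≤
      ((A.filter fun a => cls a = cls o).card : ℝ) + ((A.filter fun a => cls a = cls y).card : ℝ))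
    (hpair : ∀ a ∈ A, ∀ a' ∈ A, a ≠ a' → (prodBernoulli w).real (openConn a a')ᶜ ≤ t) :
    (prodBernoulli w).real {ω : BondConfig (Fin n) |
        1 ≤ (A.filter fun a => ω ∈ openConn o a).card ∧
        ((A.filter fun a => ω ∈ openConn o a).card : ℝ) <
          (∑ a ∈ A, (prodBernoulli w).real (openConn o a)) / 2} ≤ t := by
  have hxy : x ≠ y := fun h => hcy (by rw [← h, hcx])
  refine oneCut_of_blobs_trap w A o t cls hcls _ (openConn x y)ᶜ (fun ω hω hxy' => ?_)
    (hpair x hx y hy hxy)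
  obtain ⟨⟨-, hlt⟩, hωG⟩ := hω
  have hox : (openGraph ω).Reachable o x :=
    hωG o (Finset.mem_insert_self _ _) x (Finset.mem_insert_of_mem hx) hcx.symm
  have hoy : (openGraph ω).Reachable o y := hox.trans hxy'
  have hge := blobs_count_ge A o cls ω hωG hy hoy hcy
  have hge' : ((A.filter fun a => cls a = cls o).card : ℝ) +
      ((A.filter fun a => cls a = cls y).card : ℝ) ≤
        ((A.filter fun a => ω ∈ openConn o a).card : ℝ) := by exact_mod_cast hge
  linarith

/-! ## Four labels with an unused non-observer label: relabel to three blobs -/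

/-- A four-label blob structure in which some non-observer label carries no relay is a three-blob
structure after relabelling, so the one-cut bound holds by `oneCut_of_threeBlobs`. [folklore] -/
theorem oneCut_of_fourBlobs_of_emptyLabel (w : Sym2 (Fin n) → unitInterval) (A : Finset (Fin n))
    (o : Fin n) (t : ℝ) (cls : Fin n → Fin 4)
    (hcls : ∀ u ∈ insert o A, ∀ v ∈ insert o A, cls u = cls v →
      (prodBernoulli w).real (openConn u v)ᶜ = 0)
    (i : Fin 4) (hi : i ≠ cls o) (hempty : ∀ a ∈ A, cls a ≠ i) (ht : 0 ≤ t)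
    (hpair : ∀ a ∈ A, ∀ a' ∈ A, a ≠ a' → (prodBernoulli w).real (openConn a a')ᶜ ≤ t) :
    (prodBernoulli w).real {ω : BondConfig (Fin n) |
        1 ≤ (A.filter fun a => ω ∈ openConn o a).card ∧
        ((A.filter fun a => ω ∈ openConn o a).card : ℝ) <
          (∑ a ∈ A, (prodBernoulli w).real (openConn o a)) / 2} ≤ t := by
  -- an explicit map `Fin 4 → Fin 3` injective away from `i`
  obtain ⟨ψ, hψ⟩ : ∃ ψ : Fin 4 → Fin 3, ∀ x y : Fin 4, x ≠ i → y ≠ i → ψ x = ψ y → x = y := by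
    refine ⟨fun x => if h : x.val < i.val then ⟨x.val, by omega⟩ else ⟨x.val - 1, by omega⟩,
      fun x y hx hy hxy => ?_⟩
    have hx' : x.val ≠ i.val := fun h => hx (Fin.ext h)
    have hy' : y.val ≠ i.val := fun h => hy (Fin.ext h)
    apply Fin.ext
    by_cases h1 : x.val < i.val <;> by_cases h2 : y.val < i.val <;>
      simp only [h1, h2, dite_true, dite_false, Fin.mk.injEq] at hxy <;> omega
  have hnot : ∀ u ∈ insert o A, cls u ≠ i := by
    intro u hu
    rcases Finset.mem_insert.1 hu with rfl | hu
    · exact fun h => hi h.symm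
    · exact hempty u hu
  exact oneCut_of_threeBlobs n w A o t (ψ ∘ cls)
    (fun u hu v hv huv => hcls u hu v hv (hψ _ _ (hnot u hu) (hnot v hv) huv)) ht hpair

/-! ## Four blobs, observer-free -/

/-- Pigeonhole in `Fin 4`: four pairwise distinct labels exhaust `Fin 4`. [folklore] -/
theorem fin4_exhaust {p q r s : Fin 4} (hpq : p ≠ q) (hpr : p ≠ r) (hps : p ≠ s) (hqr : q ≠ r)
    (hqs : q ≠ s) (hrs : r ≠ s) (x : Fin 4) : x = p ∨ x = q ∨ x = r ∨ x = s := by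
  omega

/-- **The one-cut bound for four blobs whose observer blob carries no relay, unconditional.**  Same
binder shape as the hypothesis of `Theorems.noHeavyLowerTail_of_oneCut`, plus a blob structure
`cls : Fin n → Fin 4` on `insert o A` with no relay in the observer's blob.  Light pair of relay blobs ⇒
the heavy-class exit inequality `lonelyOrPair_le`; all pairs heavy ⇒ the lonely-relay lemma
`lonelyRelay_three`; both are corollaries of the tripod exchange inequality C⁺ (BHK 2006, Thm. 1.5).
Generalises `oneCut_card_le_three` (masses `(0;1,1,1)`) to arbitrary masses.
[cite: VandenbergHaggstromKahn2005, Thm. 1.5 — via tripodExchange] -/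
theorem oneCut_of_fourBlobs_observerFree :
    ∀ (n : ℕ) (w : Sym2 (Fin n) → unitInterval) (A : Finset (Fin n)) (o : Fin n) (t : ℝ)
      (cls : Fin n → Fin 4),
      (∀ u ∈ insert o A, ∀ v ∈ insert o A, cls u = cls v →
        (Literature.Probability.LatticeModels.prodBernoulli w).real
          (Literature.Probability.Percolation.openConn u v)ᶜ = 0) →
      (∀ a ∈ A, cls a ≠ cls o) →
      0 ≤ t →
      (∀ a ∈ A, ∀ a' ∈ A, a ≠ a' →
        (Literature.Probability.LatticeModels.prodBernoulli w).real
          (Literature.Probability.Percolation.openConn a a')ᶜ ≤ t) →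
      (Literature.Probability.LatticeModels.prodBernoulli w).real
        {ω : Literature.Probability.Percolation.BondConfig (Fin n) |
          1 ≤ (A.filter fun a => ω ∈ Literature.Probability.Percolation.openConn o a).card ∧
          ((A.filter fun a => ω ∈ Literature.Probability.Percolation.openConn o a).card : ℝ) <
            (∑ a ∈ A, (Literature.Probability.LatticeModels.prodBernoulli w).real
              (Literature.Probability.Percolation.openConn o a)) / 2} ≤ t := by
  intro n w A o t cls hcls hfree ht hpair
  set μ := prodBernoulli w with hμ
  set EN := ∑ a ∈ A, μ.real (openConn o a) with hEN
  set m : Fin 4 → ℕ := fun i => (A.filter fun a => cls a = i).card with hm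
  have hT : EN / 2 ≤ (A.card : ℝ) / 2 := by
    have := expectedCount_le_card w A o
    linarith
  -- degenerate structures: an unused non-observer label
  by_cases hdeg : ∃ i : Fin 4, i ≠ cls o ∧ ∀ a ∈ A, cls a ≠ i
  · obtain ⟨i, hi, hempty⟩ := hdeg
    exact oneCut_of_fourBlobs_of_emptyLabel w A o t cls hcls i hi hempty ht hpair
  push Not at hdeg
  -- hdeg : ∀ i, i ≠ cls o → ∃ a ∈ A, cls a = i
  by_cases hlight : ∃ a ∈ A, ∃ b ∈ A, cls a ≠ cls b ∧
      ((m (cls a) : ℝ) + (m (cls b) : ℝ)) < EN / 2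
  · -- LIGHT PAIR: the third relay blob is heavy; heavy-class exit
    obtain ⟨a, ha, b, hb, hab, hlt⟩ := hlight
    -- a relay outside the two light blobs exists
    have hc : ∃ c ∈ A, cls c ≠ cls a ∧ cls c ≠ cls b := by
      by_contra hno
      push Not at hno
      have hsub : A ⊆ (A.filter fun d => cls d = cls a) ∪ (A.filter fun d => cls d = cls b) := by
        intro d hd
        simp only [Finset.mem_union, Finset.mem_filter]
        by_cases h : cls d = cls a
        · exact Or.inl ⟨hd, h⟩
        · exact Or.inr ⟨hd, hno d hd h⟩
      have hcard : A.card ≤ m (cls a) + m (cls b) :=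
        (Finset.card_le_card hsub).trans (Finset.card_union_le _ _)
      have hcard' : (A.card : ℝ) ≤ (m (cls a) : ℝ) + (m (cls b) : ℝ) := by exact_mod_cast hcard
      have hpos : (1 : ℝ) ≤ A.card := by exact_mod_cast Finset.card_pos.2 ⟨a, ha⟩
      linarith
    obtain ⟨c, hc, hca, hcb⟩ := hc
    -- the labels `cls o, cls a, cls b, cls c` exhaust `Fin 4`
    have hoa := hfree a ha; have hob := hfree b hb; have hoc := hfree c hc
    have hexh : ∀ d ∈ A, cls d = cls a ∨ cls d = cls b ∨ cls d = cls c := by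
      intro d hd
      rcases fin4_exhaust (Ne.symm hoa) (Ne.symm hob) (Ne.symm hoc) hab (Ne.symm hca) (Ne.symm hcb)
        (cls d) with h | h | h | h
      · exact absurd h (hfree d hd)
      · exact Or.inl h
      · exact Or.inr (Or.inl h)
      · exact Or.inr (Or.inr h)
    -- the third blob is heavy
    have hheavy : EN / 2 ≤ (m (cls c) : ℝ) := by
      have hsub : A ⊆ ((A.filter fun d => cls d = cls a) ∪ (A.filter fun d => cls d = cls b)) ∪
          (A.filter fun d => cls d = cls c) := by
        intro d hd
        simp only [Finset.mem_union, Finset.mem_filter]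
        rcases hexh d hd with h | h | h
        · exact Or.inl (Or.inl ⟨hd, h⟩)
        · exact Or.inl (Or.inr ⟨hd, h⟩)
        · exact Or.inr ⟨hd, h⟩
      have hcard : A.card ≤ m (cls a) + m (cls b) + m (cls c) :=
        (Finset.card_le_card hsub).trans
          ((Finset.card_union_le _ _).trans (by gcongr; exact Finset.card_union_le _ _))
      have hcard' : (A.card : ℝ) ≤ (m (cls a) : ℝ) + (m (cls b) : ℝ) + (m (cls c) : ℝ) := by
        exact_mod_cast hcard
      linarith
    have hac' : a ≠ c := fun h => hca (by rw [h])
    have hbc' : b ≠ c := fun h => hcb (by rw [h])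
    refine oneCut_of_blobs_trap w A o t cls hcls _ ((openConn o c)ᶜ ∩ (openConn o a ∪ openConn o b))
      (fun ω hω => ?_) (lonelyOrPair_le w o a b c t (hpair a ha c hc hac') (hpair b hb c hc hbc'))
    obtain ⟨⟨h1, hNlt⟩, hωG⟩ := hω
    -- `o` misses the heavy blob
    have hmiss : ∀ y ∈ A, cls y = cls c → ¬ (openGraph ω).Reachable o y := by
      intro y hy hcy hoy
      have hge := blobs_count_ge_one A o cls ω hωG hy hoy
      have hge' : (m (cls c) : ℝ) ≤ ((A.filter fun d => ω ∈ openConn o d).card : ℝ) := by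
        rw [← hcy]; exact_mod_cast hge
      linarith
    refine ⟨hmiss c hc rfl, ?_⟩
    -- some relay is reached; it lies in `a`'s or `b`'s blob
    obtain ⟨d, hd⟩ := Finset.card_pos.1 h1
    obtain ⟨hdA, hod⟩ := Finset.mem_filter.1 hd
    rcases hexh d hdA with h | h | h
    · exact Or.inl (hod.trans
        (hωG d (Finset.mem_insert_of_mem hdA) a (Finset.mem_insert_of_mem ha) h))
    · exact Or.inr (hod.trans
        (hωG d (Finset.mem_insert_of_mem hdA) b (Finset.mem_insert_of_mem hb) h))
    · exact absurd hod (hmiss d hdA h)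
  · -- ALL PAIRS HEAVY: `o` reaches exactly one relay blob; lonely-relay lemma
    push Not at hlight
    -- hlight : ∀ a ∈ A, ∀ b ∈ A, cls a ≠ cls b → EN / 2 ≤ m (cls a) + m (cls b)
    -- name the three non-observer labels and pick representatives
    obtain ⟨j, k, l, hj, hk, hl, hjk, hjl, hkl⟩ : ∃ j k l : Fin 4, j ≠ cls o ∧ k ≠ cls o ∧ l ≠ cls o ∧
        j ≠ k ∧ j ≠ l ∧ k ≠ l := by
      generalize cls o = i
      revert i
      decide
    obtain ⟨a, ha, hca⟩ := hdeg j hj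
    obtain ⟨b, hb, hcb⟩ := hdeg k hk
    obtain ⟨c, hc, hcc⟩ := hdeg l hl
    have hab : a ≠ b := fun h => hjk (by rw [← hca, ← hcb, h])
    have hac : a ≠ c := fun h => hjl (by rw [← hca, ← hcc, h])
    have hbc : b ≠ c := fun h => hkl (by rw [← hcb, ← hcc, h])
    have hexh : ∀ d ∈ A, cls d = cls a ∨ cls d = cls b ∨ cls d = cls c := by
      intro d hd
      rw [hca, hcb, hcc]
      rcases fin4_exhaust (Ne.symm hj) (Ne.symm hk) (Ne.symm hl) hjk hjl hkl (cls d) with h | h | h | h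
      · exact absurd h (hfree d hd)
      · exact Or.inl h
      · exact Or.inr (Or.inl h)
      · exact Or.inr (Or.inr h)
    set Ea := (openConn o a ∩ (openConn o b)ᶜ ∩ (openConn o c)ᶜ : Set (BondConfig (Fin n))) with hEa
    set Eb := (openConn o b ∩ (openConn o a)ᶜ ∩ (openConn o c)ᶜ : Set (BondConfig (Fin n))) with hEb
    set Ec := (openConn o c ∩ (openConn o a)ᶜ ∩ (openConn o b)ᶜ : Set (BondConfig (Fin n))) with hEc
    have hE : μ.real (Ea ∪ Eb ∪ Ec) ≤ t :=
      calc μ.real (Ea ∪ Eb ∪ Ec) ≤ μ.real Ea + μ.real Eb + μ.real Ec :=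
            (measureReal_union_le _ _).trans (by gcongr; exact measureReal_union_le _ _)
        _ ≤ max (μ.real (openConn b c)ᶜ) (μ.real (openConn a c)ᶜ) := lonelyRelay_three w o a b c
        _ ≤ t := max_le (hpair b hb c hc hbc) (hpair a ha c hc hac)
    refine oneCut_of_blobs_trap w A o t cls hcls _ (Ea ∪ Eb ∪ Ec) (fun ω hω => ?_) hE
    obtain ⟨⟨h1, hNlt⟩, hωG⟩ := hω
    -- no two relay blobs are reached
    have htwo : ∀ x ∈ A, ∀ y ∈ A, cls x ≠ cls y → (openGraph ω).Reachable o x →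
        ¬ (openGraph ω).Reachable o y := by
      intro x hx y hy hxy hox hoy
      have hge := blobs_count_ge_two A o cls ω hωG hx hy hox hoy hxy
      have hge' : (m (cls x) : ℝ) + (m (cls y) : ℝ) ≤
          ((A.filter fun d => ω ∈ openConn o d).card : ℝ) := by exact_mod_cast hge
      have := hlight x hx y hy hxy
      linarith
    have hcab : cls a ≠ cls b := by rw [hca, hcb]; exact hjk
    have hcac : cls a ≠ cls c := by rw [hca, hcc]; exact hjl
    have hcbc : cls b ≠ cls c := by rw [hcb, hcc]; exact hkl
    -- some relay is reached: its representative is the lonely one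
    obtain ⟨d, hd⟩ := Finset.card_pos.1 h1
    obtain ⟨hdA, hod⟩ := Finset.mem_filter.1 hd
    have mem : ∀ x y : Fin n, ω ∈ (openConn x y : Set (BondConfig (Fin n))) ↔
        (openGraph ω).Reachable x y := fun _ _ => Iff.rfl
    simp only [hEa, hEb, hEc, Set.mem_union, Set.mem_inter_iff, Set.mem_compl_iff, mem]
    rcases hexh d hdA with h | h | h
    · have hoa : (openGraph ω).Reachable o a :=
        hod.trans (hωG d (Finset.mem_insert_of_mem hdA) a (Finset.mem_insert_of_mem ha) h)
      exact Or.inl (Or.inl ⟨⟨hoa, htwo a ha b hb hcab hoa⟩, htwo a ha c hc hcac hoa⟩)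
    · have hob : (openGraph ω).Reachable o b :=
        hod.trans (hωG d (Finset.mem_insert_of_mem hdA) b (Finset.mem_insert_of_mem hb) h)
      exact Or.inl (Or.inr ⟨⟨hob, htwo b hb a ha (Ne.symm hcab) hob⟩, htwo b hb c hc hcbc hob⟩)
    · have hoc : (openGraph ω).Reachable o c :=
        hod.trans (hωG d (Finset.mem_insert_of_mem hdA) c (Finset.mem_insert_of_mem hc) h)
      exact Or.inr ⟨⟨hoc, htwo c hc a ha (Ne.symm hcac) hoc⟩, htwo c hc b hb (Ne.symm hcbc) hoc⟩

end Summit.CriticalPhenomena.PercolationContinuityZ3.Theorems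

end
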